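import Literature.AlgebraicGeometry.Resolution.QuadraticTransformsProofs
import Literature.AlgebraicGeometry.Resolution.QuadraticTransformsRegular
import Literature.AlgebraicGeometry.Resolution.QuadraticTransforms
import Literature.AlgebraicGeometry.Resolution.LocalBlowup
import Literature.AlgebraicGeometry.Resolution.ArithmeticalThreefolds
import Summits.ResolutionOfSingularities.ResolutionOfSingularities.Theorems.IndSmoothValuativeSmoothingQuadraticSequence
import Summits.ResolutionOfSingularities.ResolutionOfSingularities.Theorems.IndSmoothValuativeSmoothingSequenceCollapse
import Summits.ResolutionOfSingularities.ResolutionOfSingularities.Theorems.IndSmoothValuativeSmoothingDominatesDimLeOne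
import Summits.ResolutionOfSingularities.ResolutionOfSingularities.Theorems.IndSmoothValuativeSmoothingRegularCentre
import HarnessLib

/-!
# From absolute to relative local uniformization at a regular centre of dimension `≤ 2`
# (`stub_lurel_of_regularCentre`, crux `ShadowsUniformize`, line `birth`)

Stub `stub_lurel_of_regularCentre` of the birth line of the crux `ShadowsUniformize`
(stmt-ResolutionOfSingularities-16756, route `AbhyankarShadows`), lead reshape #5: the
regular-centre branch `HasRegularCentreDimLeTwo`.

**Theorem (transfer).** Let `k ⊆ K` be fields (any characteristic, any residue field, any value
group), `O` a valuation ring of `K`, and `B ⊆ O` a finitely generated `k`-subalgebra with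
`Frac B = K` whose localisation `B_𝔭` at the centre `𝔭 = 𝔪_O ∩ B` is a REGULAR local ring of
Krull dimension `≤ 2` (absolute local uniformization of `O` on ONE model). Then for EVERY
finitely generated `k`-subalgebra `R ⊆ O` there is a finitely generated `A` with
`R ≤ A ⊆ O`, `Frac A = K`, which is regular at the centre `𝔪_O ∩ A` (relative local
uniformization of `O`).

**Proof.** Work with `R₀ = locAtCentre B O ≅ B_𝔭` (`locAtCentreEquiv`,
`isRegularLocalRing_locAtCentre_iff`), a regular local ring of `K` dominated by `O`.
* `dim R₀ ≤ 1`: `O = R₀` (`ValuativeSmoothing.stub_eqOfDominatesOfDimLeOne`: `R₀` is a field or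
  a discrete valuation ring, hence a valuation ring dominated by `O`). Take `A = B[s]`, `s` the
  generators of `R`; then `B ≤ A ≤ O = locAtCentre B O`, so `locAtCentre A O = locAtCentre B O`
  (sandwich, `locAtCentre_mono` + `locAtCentre_locAtCentre`) is regular.
* `dim R₀ = 2`: `O ≠ K`, and the quadratic sequence `R₀ = R 0 → R 1 → ⋯` along `O` exists
  (`ValuativeSmoothing.stub_quadraticSequence`). By ABHYANKAR'S UNION LEMMA (Abhyankar 1956,
  Lemma 12 = Cutkosky, Lemma 2.2; PROVED in the tree as `AbhyankarQuadraticUnion_holds`)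
  `O = ⋃ R n`, so the generators `s` of `R` lie in some `R N`; `R N` is regular
  (`isRegularLocalRing_sequence`, Abhyankar 1956, Prop. 8) and equals `locAtCentre (B[t]) O` for a
  finite `t ⊆ O` (towers of local blowing ups collapse, `ValuativeSmoothing.stub_sequenceCollapse`).
  Take `A = B[t, s]`: `B[t] ≤ A ≤ R N = locAtCentre (B[t]) O`, so again
  `locAtCentre A O = R N` is regular.
In both cases `A` is finitely generated, contains `R = k[s]` and `B` (so `Frac A = K`,
`isFractionRing_of_le`), and regularity is moved back to `Localization.AtPrime (𝔪_O ∩ A)` by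
`isRegularLocalRing_locAtCentre_iff` (`lurel_model_of_regular_locAtCentre`). No named facts.

## Sources

* S. S. Abhyankar, *On the valuations centered in a local domain*, Amer. J. Math. 78 (1956)
  321–348: Lemma 12 (union of the quadratic sequence), Prop. 8. [Abhyankar1956Valuations]
* S. D. Cutkosky, *Ramification of valuations and local rings in positive characteristic*
  (2014), Lemma 2.2 (Abhyankar's union lemma as quoted). [Cutkosky2014]
* J. Novacoski, M. Spivakovsky, *Reduction of local uniformization to the rank one case* (2014),
  Def. 2.8, Lemma 2.9 (local blowing ups, towers collapse). [NovacoskiSpivakovsky2014]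
* O. Zariski, *The reduction of the singularities of an algebraic surface*, Ann. of Math. 40
  (1939) 639–689 (context: uniformization at a simple point). [Zariski1939]
-/

noncomputable section

-- single-problem summit: the doubled namespace component is forced
set_option linter.dupNamespace false

open Literature.AlgebraicGeometry.Resolution IsLocalRing

namespace Summit.ResolutionOfSingularities.ResolutionOfSingularities.Theorems

/-! ## Finitely generated models with a prescribed local ring at the centre -/

/-- The subring underlying `k`-adjunction to a `k`-subalgebra `B`: `(B[u]).toSubring` is the
subring generated by `B ∪ u` (the constants of `k` already lie in `B`). [folklore] -/
theorem toSubring_adjoin_subalgebra_union {k K : Type} [Field k] [Field K] [Algebra k K]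
    (B : Subalgebra k K) (u : Set K) :
    (Algebra.adjoin k ((B : Set K) ∪ u)).toSubring = Subring.closure ((B : Set K) ∪ u) := by
  rw [Algebra.adjoin_eq_ring_closure]
  apply le_antisymm
  · refine Subring.closure_le.mpr ?_
    rintro z (⟨c, rfl⟩ | hz)
    · exact Subring.subset_closure (Or.inl (B.algebraMap_mem c))
    · exact Subring.subset_closure hz
  · exact Subring.closure_mono Set.subset_union_right

/-- **Sandwich rule** for the local ring at the centre: `C ≤ A ≤ locAtCentre C O` forces
`locAtCentre A O = locAtCentre C O` (monotonicity and idempotence of `locAtCentre`).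
[cite: NovacoskiSpivakovsky2014, Lemma 2.5] -/
theorem locAtCentre_eq_of_le_of_le_locAtCentre {K : Type} [Field K] (O : ValuationSubring K)
    {C A : Subring K} (h₁ : C ≤ A) (h₂ : A ≤ locAtCentre C O) :
    locAtCentre A O = locAtCentre C O :=
  le_antisymm ((locAtCentre_mono O h₂).trans (locAtCentre_locAtCentre C O).le)
    (locAtCentre_mono O h₁)

/-- **The model `B[u]`.** Let `B ⊆ K` be a finitely generated `k`-subalgebra with `Frac B = K`,
`C` a subring with `B ≤ C ⊆ O` whose local ring `locAtCentre C O` at the centre of `O` is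
regular, and `u ⊆ locAtCentre C O` a finite set with `C ≤ ⟨B ∪ u⟩`. Then `A = B[u]` is a
finitely generated model of `K` inside `O` with `locAtCentre A O = locAtCentre C O`, hence
regular at the centre `𝔪_O ∩ A` (`isRegularLocalRing_locAtCentre_iff`), and it contains every
`R ≤ B[u]`. [folklore] -/
theorem lurel_model_of_regular_locAtCentre (k K : Type) [Field k] [Field K] [Algebra k K]
    (O : ValuationSubring K) (B : Subalgebra k K) (hBfg : B.FG) (hfrac : IsFractionRing B K)
    (C : Subring K) (hBC : B.toSubring ≤ C) (hCO : C ≤ O.toSubring)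
    (hreg : IsRegularLocalRing (locAtCentre C O))
    (u : Finset K) (hu : (↑u : Set K) ⊆ locAtCentre C O)
    (hCu : C ≤ Subring.closure ((B : Set K) ∪ ↑u))
    (R : Subalgebra k K) (hRu : R ≤ Algebra.adjoin k ((B : Set K) ∪ ↑u)) :
    ∃ (A : Subalgebra k K) (h : A.toSubring ≤ O.toSubring), R ≤ A ∧ A.FG ∧
      IsFractionRing A K ∧ IsRegularLocalRing
        (Localization.AtPrime (Ideal.comap (Subring.inclusion h) (IsLocalRing.maximalIdeal O))) := by
  classical
  set A : Subalgebra k K := Algebra.adjoin k ((B : Set K) ∪ ↑u) with hAdef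
  have hA : A.toSubring = Subring.closure ((B : Set K) ∪ ↑u) :=
    toSubring_adjoin_subalgebra_union B ↑u
  -- `C ≤ A ≤ locAtCentre C O ≤ O`
  have hCA : C ≤ A.toSubring := by rw [hA]; exact hCu
  have hAS : A.toSubring ≤ locAtCentre C O := by
    rw [hA]
    exact Subring.closure_le.mpr (Set.union_subset (hBC.trans (le_locAtCentre C O)) hu)
  have hAO : A.toSubring ≤ O.toSubring := hAS.trans (locAtCentre_le hCO)
  have heq : locAtCentre A.toSubring O = locAtCentre C O :=
    locAtCentre_eq_of_le_of_le_locAtCentre O hCA hAS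
  have hregA : IsRegularLocalRing (locAtCentre A.toSubring O) := by rw [heq]; exact hreg
  have hBA : B ≤ A := fun x hx => Algebra.subset_adjoin (Or.inl hx)
  refine ⟨A, hAO, hRu, ?_, isFractionRing_of_le hBA hfrac,
    (isRegularLocalRing_locAtCentre_iff hAO).mp hregA⟩
  rw [hAdef, Algebra.adjoin_union, Algebra.adjoin_eq B]
  exact hBfg.sup (Subalgebra.fg_adjoin_finset u)

/-! ## The transfer -/

/-- **Stub `stub_lurel_of_regularCentre` (crux `ShadowsUniformize`, line `birth`, reshape #5):
from ONE regular centre of dimension `≤ 2` to relative local uniformization for EVERY `R`.**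
For fields `k ⊆ K`, a valuation ring `O` of `K` and a finitely generated `k`-subalgebra `B ⊆ O`
with `Frac B = K` whose localisation at the centre `𝔪_O ∩ B` is a regular local ring of Krull
dimension `≤ 2`, every finitely generated `R ⊆ O` is dominated by a finitely generated `A ⊆ O`
with `Frac A = K` which is regular at the centre `𝔪_O ∩ A`. Dimension `≤ 1`: `O` is the local
ring `locAtCentre B O` itself (`ValuativeSmoothing.stub_eqOfDominatesOfDimLeOne`) and `A = B[s]`
(`s` the generators of `R`). Dimension `2`: the quadratic sequence along `O`
(`ValuativeSmoothing.stub_quadraticSequence`) exhausts `O` (Abhyankar's union lemma,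
`AbhyankarQuadraticUnion_holds`), so `s ⊆ R N` for some `N`; `R N` is regular
(`isRegularLocalRing_sequence`) and is `locAtCentre (B[t]) O` for a finite `t ⊆ O`
(`ValuativeSmoothing.stub_sequenceCollapse`); `A = B[t, s]`
(`lurel_model_of_regular_locAtCentre`). [cite: Abhyankar1956Valuations, Lemma 12] -/
theorem stub_lurel_of_regularCentre (k K : Type) [Field k] [Field K] [Algebra k K]
    (O : ValuationSubring K) (B : Subalgebra k K) (hBfg : B.FG) (hBO : B.toSubring ≤ O.toSubring)
    (hfrac : IsFractionRing B K)
    (hreg : IsRegularLocalRing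
      (Localization.AtPrime (Ideal.comap (Subring.inclusion hBO) (IsLocalRing.maximalIdeal O))))
    (hdim : ringKrullDim
      (Localization.AtPrime (Ideal.comap (Subring.inclusion hBO) (IsLocalRing.maximalIdeal O))) ≤ 2)
    (R : Subalgebra k K) (hR : R.FG) (hRO : R.toSubring ≤ O.toSubring) :
    ∃ (A : Subalgebra k K) (h : A.toSubring ≤ O.toSubring), R ≤ A ∧ A.FG ∧
      IsFractionRing A K ∧ IsRegularLocalRing
        (Localization.AtPrime (Ideal.comap (Subring.inclusion h) (IsLocalRing.maximalIdeal O))) := by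
  classical
  -- (0) move regularity and dimension to `locAtCentre B O ≅ B_𝔭`
  have hreg' : IsRegularLocalRing (locAtCentre B.toSubring O) :=
    (isRegularLocalRing_locAtCentre_iff hBO).mpr hreg
  have hdim' : ringKrullDim (locAtCentre B.toSubring O) ≤ 2 := by
    rw [← ringKrullDim_eq_of_ringEquiv (locAtCentreEquiv hBO).toRingEquiv]
    exact hdim
  haveI := hreg'
  have hdom : SubringDominates (locAtCentre B.toSubring O) O.toSubring :=
    subringDominates_locAtCentre hBO
  have hof : IsLocalRingOf (locAtCentre B.toSubring O) := by
    refine ⟨inferInstance, fun z => ?_⟩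
    obtain ⟨a, b, hb, rfl⟩ := IsFractionRing.div_surjective (A := B) z
    refine ⟨a, le_locAtCentre _ O a.2, b, le_locAtCentre _ O b.2, ?_, rfl⟩
    have hb0 : b ≠ 0 := nonZeroDivisors.ne_zero hb
    exact fun h => hb0 (Subtype.ext h)
  -- the generators of `R`
  obtain ⟨s, hs⟩ := hR
  have hsR : (↑s : Set K) ⊆ R := hs ▸ Algebra.subset_adjoin
  by_cases h1 : ringKrullDim (locAtCentre B.toSubring O) ≤ 1
  · -- (1) dimension ≤ 1: `O` is the local ring at the centre itself; `A = B[s]`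
    have hO : O.toSubring = locAtCentre B.toSubring O :=
      ValuativeSmoothing.stub_eqOfDominatesOfDimLeOne O _ hreg' h1 hof hdom
    refine lurel_model_of_regular_locAtCentre k K O B hBfg hfrac B.toSubring le_rfl hBO hreg' s
      ?_ (fun x hx => Subring.subset_closure (Or.inl hx)) R ?_
    · rw [← hO]
      exact fun x hx => hRO (hsR hx)
    · rw [← hs]
      exact Algebra.adjoin_mono Set.subset_union_right
  -- (2) dimension 2: the quadratic sequence along `O`
  have h2 : ringKrullDim (locAtCentre B.toSubring O) = 2 :=
    ValuativeSmoothing.ringKrullDim_eq_two_of_le_two hdim' h1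
  have hOtop : O ≠ ⊤ := by
    rintro rfl
    have h0 := ValuativeSmoothing.ringKrullDim_eq_zero_of_subringDominates_top _ hdom
    rw [h0] at h2
    exact absurd h2 (by decide)
  obtain ⟨Rs, hRs0, hstep⟩ := ValuativeSmoothing.stub_quadraticSequence O hOtop _ hreg' hof hdom
  have hreg0 : IsRegularLocalRing (Rs 0) := by rw [hRs0]; exact hreg'
  have h20 : ringKrullDim (Rs 0) = 2 := by rw [hRs0]; exact h2
  have hof0 : IsLocalRingOf (Rs 0) := by rw [hRs0]; exact hof
  have hdom0 : SubringDominates (Rs 0) O.toSubring := by rw [hRs0]; exact hdom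
  have hunion := AbhyankarQuadraticUnion_holds K O Rs hreg0 h20 hof0 hdom0 hstep
  -- the generators of `R` lie in some `Rs N`
  have hmono := sequence_monotone hstep
  have hsN : ∃ N, (↑s : Set K) ⊆ Rs N := by
    have hx : ∀ x ∈ s, ∃ i, x ∈ Rs i := fun x hx => (hunion x).mp (hRO (hsR hx))
    choose i hi using hx
    refine ⟨s.attach.sup fun x => i x.1 x.2, fun x hx => ?_⟩
    exact hmono (Finset.le_sup (f := fun x : {x // x ∈ s} => i x.1 x.2)
      (Finset.mem_attach s ⟨x, hx⟩)) (hi x hx)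
  obtain ⟨N, hN⟩ := hsN
  obtain ⟨t, htO, hRN'⟩ :=
    ValuativeSmoothing.stub_sequenceCollapse O B.toSubring hBO Rs hRs0 hstep N
  have hRN : Rs N = locAtCentre (Subring.closure ((B : Set K) ∪ ↑t)) O := hRN'
  -- the model `C = B[t] ⊆ O` with `locAtCentre C O = Rs N` regular; `A = B[t, s]`
  have hBC : B.toSubring ≤ Subring.closure ((B : Set K) ∪ ↑t) :=
    fun x hx => Subring.subset_closure (Or.inl hx)
  have hCO : Subring.closure ((B : Set K) ∪ ↑t) ≤ O.toSubring :=
    Subring.closure_le.mpr (Set.union_subset hBO htO)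
  have hregC : IsRegularLocalRing (locAtCentre (Subring.closure ((B : Set K) ∪ ↑t)) O) := by
    rw [← hRN]
    exact isRegularLocalRing_sequence hreg0 hstep N
  refine lurel_model_of_regular_locAtCentre k K O B hBfg hfrac (Subring.closure ((B : Set K) ∪ ↑t))
    hBC hCO hregC (t ∪ s) ?_ ?_ R ?_
  · -- `t ∪ s ⊆ Rs N = locAtCentre (B[t]) O`
    rw [Finset.coe_union, ← hRN]
    refine Set.union_subset (fun x hx => ?_) hN
    rw [hRN]
    exact le_locAtCentre _ O (Subring.subset_closure (Or.inr hx))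
  · -- `B[t] ≤ ⟨B ∪ (t ∪ s)⟩`
    rw [Finset.coe_union]
    exact Subring.closure_mono (Set.union_subset_union_right _ Set.subset_union_left)
  · -- `R = k[s] ≤ B[t, s]`
    rw [← hs, Finset.coe_union]
    exact Algebra.adjoin_mono (Set.subset_union_right.trans Set.subset_union_right)

end Summit.ResolutionOfSingularities.ResolutionOfSingularities.Theorems

end
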